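import Literature.Analysis.FluidPDE.SelfSimilarEulerOutgoing
import Literature.Analysis.FluidPDE.SelfSimilarEulerVorticityExteriorEstimateLarge
import HarnessLib

/-!
# Outgoing self-similar Euler profiles have `γ ≥ ½` (CIV 2026 Thm 3.10, no analyticity) — tools

Analysis/FluidPDE proofs file (theorems only; no definitions, no named facts), companion of
`SelfSimilarEulerOutgoingExclusion.lean`, which DISCHARGES the named fact
`CIV2026_half_le_of_isLocallyOutgoing_of_analyticAt` (P. Constantin, M. Ignatova, V. Vicol,
*On putative self-similarity for incompressible 3D Euler*, arXiv:2602.17570 (2026), §3.5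
Thm. 3.10) by an Eulerian argument that does not use the analyticity hypothesis. Tools:

* `inner_apply_self_add_le_trace`, `inner_apply_self_le_trace_sub_mul` — if `⟪A h, h⟫ ≥ q|h|²`
  for all `h` then `⟪A w, w⟫ ≤ (tr A − (n−1) q)|w|²` (the eigenvalue bookkeeping of CIV's proof
  of Thm. 3.8, basis-free);
* `HasSelfSimilarFarFieldWith.exists_inner_transport_nonneg`, `.tendsto_norm_fderiv` — under
  the far-field bounds (3.8) (`γ > 0`) the transport field `V = γ(y−c) + U` points outward far
  out and `DU → 0` at infinity;
* `IsSelfSimilarEulerVorticityProfile.curl_eq_zero_of_weight` — **the weighted `L^{2a}`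
  identity**: for a vorticity-form profile (CIV (3.4)), `a ≥ 1`, a `C¹` exponent `ψ` and the
  radial cutoff `τ = θ_{2R,R}(· − c)`, integrating `div (|Ω|^{2a} e^{ψ} τ V) = 0` with
  `(V·∇)|Ω|^{2a} = 2a|Ω|^{2a−2}(⟪Ω, DU Ω⟫ − |Ω|²)` shows: if `⟪Ω, DU Ω⟫ ≤ m|Ω|²` and
  `2a(m − 1) + Dψ[V] + 3γ ≤ −1` on `B̄(c, 2R)`, and `⟪V, y − c⟫ ≥ 0` for `|y − c| ≥ R`, then
  `Ω ≡ 0` on `B̄(c, R)` (Chae–Shvydkoy's `|ω|^{p−2}ω` multiplier, ARMA 209 (2013) §4, with the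
  tree's translated Tao cutoffs);
* `IsSelfSimilarEulerProfile.contDiff_selfSimilarBernoulli` — the Bernoulli function is `C¹`.

References: P. Constantin, M. Ignatova, V. Vicol, arXiv:2602.17570 (2026), §3.1.3 (3.8), §3.4.3
(3.30)–(3.31), §3.5 Thm. 3.8 / Thm. 3.10 [ConstantinIgnatovaVicol2026Putative]; D. Chae,
R. Shvydkoy, ARMA 209 (2013) = arXiv:1201.6009, §4 proof of Thm 4.1 [ChaeShvydkoy2013].
Tree search: reuses `fderiv_rpow_norm_sq_apply_of_one_le`, `contDiff_rpow_norm_sq_of_one_le`, the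
translated `taoCutoff` calculus, `fderiv_curl_transport`, `integral_mul_divergence_add_eq_zero_left`,
`divergence_selfSimilarTransport`; Mathlib `LinearMap.trace_eq_sum_inner`, `tendsto_rpow_neg_atTop`.
-/

noncomputable section

open MeasureTheory Set Filter Function Topology InnerProductSpace Metric
open scoped RealInnerProductSpace NNReal

namespace Literature.Analysis.FluidPDE

/-! ### A trace inequality: a coercive quadratic form with small trace is small on each vector -/

section Trace

variable {E : Type*} [NormedAddCommGroup E] [InnerProductSpace ℝ E] [FiniteDimensional ℝ E]

/-- **Upper bound on a diagonal entry from coercivity and the trace.** If the quadratic form of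
`A` satisfies `⟪A h, h⟫ ≥ q|h|²` for all `h` and `‖w‖ = 1`, then `⟪A w, w⟫ + (n − 1) q ≤ tr A`,
`n = dim E` (expand the trace in an orthonormal basis through `w`). This is the eigenvalue
bookkeeping of CIV's proof of Thm. 3.8 ("`λ_min(𝕊_{y_*}) ≥ c_* − γ`, thus … the largest eigenvalue
satisfies `λ_max(𝕊_{y_*}) ≤ 2(γ − c_*)`") in basis-free form. [cite: ConstantinIgnatovaVicol2026Putative, §3.5 proof of Thm. 3.8 (eigenvalue interval)] -/
theorem inner_apply_self_add_le_trace {A : E →L[ℝ] E} {w : E} (hw : ‖w‖ = 1) {q : ℝ}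
    (hq : ∀ h, q * ‖h‖ ^ 2 ≤ ⟪A h, h⟫) :
    ⟪A w, w⟫ + ((Module.finrank ℝ E : ℝ) - 1) * q ≤ LinearMap.trace ℝ E (A : E →ₗ[ℝ] E) := by
  classical
  have hon : Orthonormal ℝ ((↑) : ({w} : Set E) → E) := by
    rw [orthonormal_subtype_iff_ite]
    intro v hv v' hv'
    rw [Set.mem_singleton_iff] at hv hv'
    subst hv; subst hv'
    simp [hw]
  obtain ⟨u, b, hwu, hb⟩ := hon.exists_orthonormalBasis_extension
  have hw_mem : w ∈ u := by
    have : w ∈ ({w} : Set E) := Set.mem_singleton w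
    exact_mod_cast hwu this
  have hcard : (Module.finrank ℝ E : ℝ) = u.card := by
    rw [Module.finrank_eq_card_basis b.toBasis, Fintype.card_coe]
  rw [LinearMap.trace_eq_sum_inner _ b]
  have hsum : ∑ i, ⟪b i, (A : E →ₗ[ℝ] E) (b i)⟫ = ∑ x ∈ u, ⟪x, A x⟫ := by
    rw [← Finset.sum_coe_sort u (fun x => ⟪x, A x⟫)]
    refine Finset.sum_congr rfl fun i _ => ?_
    rw [hb]
    rfl
  rw [hsum, ← Finset.add_sum_erase u _ hw_mem]
  have hterm : ∀ x ∈ u.erase w, q ≤ ⟪x, A x⟫ := by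
    intro x hx
    have hxu : x ∈ u := Finset.mem_of_mem_erase hx
    have hx1 : ‖x‖ = 1 := by
      have := b.orthonormal.1 ⟨x, hxu⟩
      rw [hb] at this
      exact this
    have := hq x
    rw [hx1, one_pow, mul_one, real_inner_comm] at this
    exact this
  have hle := Finset.card_nsmul_le_sum (u.erase w) (fun x => ⟪x, A x⟫) q hterm
  rw [Finset.card_erase_of_mem hw_mem, nsmul_eq_mul,
    Nat.cast_sub (Finset.card_pos.2 ⟨w, hw_mem⟩), Nat.cast_one] at hle
  rw [hcard, real_inner_comm w]
  linarith

/-- **Homogeneous form.** Under `⟪A h, h⟫ ≥ q|h|²` for all `h`: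
`⟪A w, w⟫ ≤ (tr A − (n − 1) q) |w|²` for every `w`. [cite: ConstantinIgnatovaVicol2026Putative, §3.5 proof of Thm. 3.8 (eigenvalue interval)] -/
theorem inner_apply_self_le_trace_sub_mul {A : E →L[ℝ] E} {q : ℝ}
    (hq : ∀ h, q * ‖h‖ ^ 2 ≤ ⟪A h, h⟫) (w : E) :
    ⟪A w, w⟫ ≤ (LinearMap.trace ℝ E (A : E →ₗ[ℝ] E) - ((Module.finrank ℝ E : ℝ) - 1) * q) *
      ‖w‖ ^ 2 := by
  by_cases hw : w = 0
  · simp [hw]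
  have hn : ‖w‖ ≠ 0 := norm_ne_zero_iff.2 hw
  set e : E := ‖w‖⁻¹ • w with he
  have he1 : ‖e‖ = 1 := by rw [he, norm_smul, norm_inv, norm_norm, inv_mul_cancel₀ hn]
  have h1 := inner_apply_self_add_le_trace (A := A) he1 hq
  have hwe : w = ‖w‖ • e := by rw [he, smul_smul, mul_inv_cancel₀ hn, one_smul]
  have h2 : ⟪A w, w⟫ = ‖w‖ ^ 2 * ⟪A e, e⟫ := by
    rw [hwe, map_smul, inner_smul_left, inner_smul_right, conj_trivial, norm_smul, norm_norm,
      he1, mul_one]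
    ring
  rw [h2]
  nlinarith [sq_nonneg ‖w‖, h1]

end Trace

/-! ### Consequences of the far-field bounds (3.8) -/

namespace HasSelfSimilarFarFieldWith

variable {γ C : ℝ} {c : EuclideanSpace ℝ (Fin 3)}
  {U : EuclideanSpace ℝ (Fin 3) → EuclideanSpace ℝ (Fin 3)}

/-- The decay factor `C (1 + t²)^{−1/(2γ)}` of (3.8) tends to `0` as `t → ∞` (`γ > 0`). [cite: ConstantinIgnatovaVicol2026Putative, §3.1.3 eq. (3.8)] -/
theorem tendsto_decayFactor (hγ : 0 < γ) (C : ℝ) :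
    Tendsto (fun t : ℝ => C * (1 + t ^ 2) ^ (-(1 / (2 * γ)))) atTop (𝓝 0) := by
  have he : 0 < 1 / (2 * γ) := by positivity
  have h1 : Tendsto (fun t : ℝ => 1 + t ^ 2) atTop atTop :=
    tendsto_atTop_add_const_left atTop 1 (tendsto_pow_atTop two_ne_zero)
  have h2 := (tendsto_rpow_neg_atTop he).comp h1
  simpa using h2.const_mul C

/-- **The transport field points outward far out** (CIV §3.5, first paragraph: "when `|y_0| > Rfl`
… `V(y)·y ≥ (γ/2)|y|²`"): under (3.8) with `γ > 0` there is `Rfl > 0` with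
`⟪γ(y − c) + U(y), y − c⟫ ≥ 0` for `|y − c| ≥ Rfl`. [cite: ConstantinIgnatovaVicol2026Putative, §3.5 (the radius Rfl, display before Def. 3.7)] -/
theorem exists_inner_transport_nonneg (hγ : 0 < γ) (h : HasSelfSimilarFarFieldWith γ c C U) :
    ∃ R : ℝ, 0 < R ∧ ∀ y, R ≤ ‖y - c‖ → 0 ≤ ⟪selfSimilarTransport γ c U y, y - c⟫ := by
  have hev : ∀ᶠ t in atTop, C * (1 + t ^ 2) ^ (-(1 / (2 * γ))) ≤ γ :=
    (tendsto_decayFactor hγ C) (Iic_mem_nhds hγ)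
  obtain ⟨R₀, hR₀⟩ := Filter.eventually_atTop.1 hev
  refine ⟨max R₀ 1, lt_max_of_lt_right one_pos, fun y hy => ?_⟩
  have hyR₀ : R₀ ≤ ‖y - c‖ := (le_max_left _ _).trans hy
  have hdec := hR₀ _ hyR₀
  have hUy := (h y).1
  rw [selfSimilarTransport_apply, inner_add_left, inner_smul_left]
  simp only [conj_trivial, real_inner_self_eq_norm_sq]
  have h1 : |⟪U y, y - c⟫| ≤ ‖U y‖ * ‖y - c‖ := abs_real_inner_le_norm _ _
  have h2 : ‖U y‖ * ‖y - c‖ ≤ γ * ‖y - c‖ ^ 2 := by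
    have hr : 0 ≤ ‖y - c‖ := norm_nonneg _
    have hpow : 0 ≤ (1 + ‖y - c‖ ^ 2) ^ (-(1 / (2 * γ))) := Real.rpow_nonneg (by positivity) _
    calc ‖U y‖ * ‖y - c‖
        ≤ C * ‖y - c‖ * (1 + ‖y - c‖ ^ 2) ^ (-(1 / (2 * γ))) * ‖y - c‖ :=
          mul_le_mul_of_nonneg_right hUy hr
      _ = C * (1 + ‖y - c‖ ^ 2) ^ (-(1 / (2 * γ))) * ‖y - c‖ ^ 2 := by ring
      _ ≤ γ * ‖y - c‖ ^ 2 := mul_le_mul_of_nonneg_right hdec (sq_nonneg _)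
  have := (abs_le.1 h1).1
  linarith

/-- **The velocity gradient tends to zero at infinity** under (3.8) with `γ > 0`:
`‖DU(y)‖ ≤ C ⟨y − c⟩^{−1/γ} → 0`. [cite: ConstantinIgnatovaVicol2026Putative, §3.1.3 eq. (3.8)] -/
theorem tendsto_norm_fderiv (hγ : 0 < γ) (h : HasSelfSimilarFarFieldWith γ c C U) :
    Tendsto (fun y => ‖fderiv ℝ U y‖) (cocompact (EuclideanSpace ℝ (Fin 3))) (𝓝 0) := by
  have h1 : Tendsto (fun y : EuclideanSpace ℝ (Fin 3) =>
      C * (1 + ‖y - c‖ ^ 2) ^ (-(1 / (2 * γ)))) (cocompact _) (𝓝 0) := by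
    have := (tendsto_decayFactor hγ C).comp (tendsto_dist_right_cocompact_atTop c)
    refine this.congr fun y => ?_
    simp [Function.comp, dist_eq_norm]
  refine squeeze_zero (fun y => norm_nonneg _) (fun y => ?_) h1
  have := (h y).2
  linarith [norm_nonneg (curl U y)]

end HasSelfSimilarFarFieldWith

/-! ### The weighted `L^{2a}` identity: a negative bracket forces `Ω ≡ 0` on a ball -/

/-- For `0 ≤ f` and `0 < a`: `f^{a−1} f = f^a` (also at `f = 0`, where `a − 1 ≥ 0` is not needed:
`0^{a-1}·0 = 0 = 0^a`). [cite: ChaeShvydkoy2013, §4, proof of Thm 4.1 (the multiplier |ω|^(p-2))] -/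
theorem rpow_sub_one_mul_self_eq_rpow {f : ℝ} (hf : 0 ≤ f) {a : ℝ} (ha : 0 < a) :
    f ^ (a - 1) * f = f ^ a := by
  rcases hf.eq_or_lt with h | h
  · rw [← h, mul_zero, Real.zero_rpow ha.ne']
  · rw [Real.rpow_sub_one h.ne']
    field_simp

namespace IsSelfSimilarEulerVorticityProfile

variable {γ : ℝ} {c : EuclideanSpace ℝ (Fin 3)}
  {U : EuclideanSpace ℝ (Fin 3) → EuclideanSpace ℝ (Fin 3)}

/-- **The weighted `L^{2a}` identity with a negative bracket** (the Eulerian core of this file).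
Let `U` be a `C²` vorticity-form profile (CIV (3.4), any `γ`), `Ω = curl U`, `V = γ(y−c) + U`;
let `a ≥ 1`, `ψ ∈ C¹`, `R > 0`, and `m` ANY real function with `⟪Ω, DU Ω⟫ ≤ m |Ω|²` on `B̄(c, 2R)`.
If the bracket is negative, `2a(m − 1) + Dψ[V] + 3γ ≤ −1` on `B̄(c, 2R)`, and the transport is
outward, `⟪V(y), y − c⟫ ≥ 0` for `|y − c| ≥ R`, then `Ω = 0` on `B̄(c, R)`. Proof: integrate
`div (|Ω|^{2a} e^{ψ} τ V) = 0`, `τ = θ_{2R,R}(· − c)`; the bracket term is `≤ −|Ω|^{2a} e^ψ τ`,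
the cutoff term `|Ω|^{2a} e^{ψ} (V·∇)τ` is `≤ 0`, so `∫ |Ω|^{2a} e^{ψ} τ ≤ 0`. [cite: ConstantinIgnatovaVicol2026Putative, §3.5 proof of Thm. 3.10 (Eulerian replacement of the Lagrangian/Cauchy-formula step)] -/
theorem curl_eq_zero_of_weight (h : IsSelfSimilarEulerVorticityProfile γ c U) {a : ℝ} (ha1 : 1 ≤ a)
    {ψ : EuclideanSpace ℝ (Fin 3) → ℝ} (hψ : ContDiff ℝ 1 ψ) {R : ℝ} (hR : 0 < R)
    {m : EuclideanSpace ℝ (Fin 3) → ℝ}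
    (hm : ∀ y, ‖y - c‖ ≤ 2 * R →
      ⟪curl U y, fderiv ℝ U y (curl U y)⟫ ≤ m y * ‖curl U y‖ ^ 2)
    (hbr : ∀ y, ‖y - c‖ ≤ 2 * R →
      2 * a * (m y - 1) + fderiv ℝ ψ y (selfSimilarTransport γ c U y) + 3 * γ ≤ -1)
    (hout : ∀ y, R ≤ ‖y - c‖ → 0 ≤ ⟪selfSimilarTransport γ c U y, y - c⟫) :
    ∀ y, ‖y - c‖ ≤ R → curl U y = 0 := by
  set Ω : EuclideanSpace ℝ (Fin 3) → EuclideanSpace ℝ (Fin 3) := curl U with hΩdef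
  set V : EuclideanSpace ℝ (Fin 3) → EuclideanSpace ℝ (Fin 3) := selfSimilarTransport γ c U
    with hVdef
  have ha : 0 < a := by linarith
  set G : EuclideanSpace ℝ (Fin 3) → ℝ := fun z => (‖Ω z‖ ^ 2) ^ a with hGdef
  set τ : EuclideanSpace ℝ (Fin 3) → ℝ := fun z => taoCutoff (2 * R) R (z - c) with hτdef
  set w : EuclideanSpace ℝ (Fin 3) → ℝ := fun z => Real.exp (ψ z) * τ z with hwdef
  have hU2 : ContDiff ℝ 2 U := h.contDiff_velocity
  have hΩ1 : ContDiff ℝ 1 Ω := contDiff_curl (n := 1) (by exact_mod_cast hU2)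
  have hΩd : Differentiable ℝ Ω := h.differentiable_curl
  have hΩc : Continuous Ω := hΩ1.continuous
  have hUd : Differentiable ℝ U := hU2.differentiable (by norm_num)
  have hV1 : ContDiff ℝ 1 V := by
    have : ContDiff ℝ 1 fun y : EuclideanSpace ℝ (Fin 3) => γ • (y - c) + U y :=
      ((contDiff_id.sub contDiff_const).const_smul γ).add (hU2.of_le (by norm_num))
    exact this
  have hG1 : ContDiff ℝ 1 G := contDiff_rpow_norm_sq_of_one_le hΩ1 ha1
  have hτ1 : ContDiff ℝ 1 τ := contDiff_taoCutoff_comp_sub (2 * R) R c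
  have he1 : ContDiff ℝ 1 fun z => Real.exp (ψ z) := hψ.exp
  have hw1 : ContDiff ℝ 1 w := he1.mul hτ1
  have hΘ1 : ContDiff ℝ 1 (fun z => G z * w z) := hG1.mul hw1
  -- compact support of the test function (from `τ`)
  have hτc : HasCompactSupport τ := by
    refine HasCompactSupport.of_support_subset_isCompact (isCompact_closedBall c (2 * R))
      fun z hz => ?_
    rw [mem_closedBall, dist_eq_norm]
    by_contra hcon
    exact hz (taoCutoff_comp_sub_eq_zero hR.le (not_le.1 hcon).le)
  have hwc : HasCompactSupport w := hτc.mul_left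
  have hΘc : HasCompactSupport (fun z => G z * w z) := hwc.mul_left
  have hτ_mem : ∀ z, τ z ∈ Icc (0 : ℝ) 1 := fun z => taoCutoff_comp_sub_mem_Icc R c z
  have hw_nn : ∀ z, 0 ≤ w z := fun z => mul_nonneg (Real.exp_pos _).le (hτ_mem z).1
  have hG_nn : ∀ z, 0 ≤ G z := fun z => Real.rpow_nonneg (sq_nonneg _) _
  have hτ_zero : ∀ z, 2 * R < ‖z - c‖ → τ z = 0 := fun z hz =>
    taoCutoff_comp_sub_eq_zero hR.le hz.le
  -- integration by parts: `∫ Θ div V + ∫ ⟪V, ∇Θ⟫ = 0`, `div V = 3γ`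
  have hibp := integral_mul_divergence_add_eq_zero_left hΘ1 hV1 hΘc
  have hdiv : ∀ y, VectorCalculus.divergence V y = 3 * γ := fun y =>
    divergence_selfSimilarTransport hUd h.divFree y
  simp_rw [hdiv] at hibp
  -- the derivative of the test function along `V`
  have hDτ : ∀ y, DifferentiableAt ℝ τ y := fun y => hτ1.differentiable one_ne_zero y
  have hDG : ∀ y, DifferentiableAt ℝ G y := fun y => hG1.differentiable one_ne_zero y
  have hDw : ∀ y, DifferentiableAt ℝ w y := fun y => hw1.differentiable one_ne_zero y
  have hDψ : ∀ y, DifferentiableAt ℝ ψ y := fun y => hψ.differentiable one_ne_zero y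
  have hDe : ∀ y, DifferentiableAt ℝ (fun z => Real.exp (ψ z)) y := fun y =>
    he1.differentiable one_ne_zero y
  have hgrad : ∀ y, ⟪V y, gradient (fun z => G z * w z) y⟫ =
      w y * fderiv ℝ G y (V y) +
        G y * (Real.exp (ψ y) * τ y * fderiv ℝ ψ y (V y) + Real.exp (ψ y) * fderiv ℝ τ y (V y)) := by
    intro y
    rw [real_inner_comm, inner_gradient_left (𝕜 := ℝ), fderiv_fun_mul (hDG y) (hDw y)]
    have hw' : fderiv ℝ w y = Real.exp (ψ y) • fderiv ℝ τ y + τ y • fderiv ℝ (fun z => Real.exp (ψ z)) y :=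
      fderiv_fun_mul (hDe y) (hDτ y)
    rw [hw', fderiv_exp (hDψ y)]
    simp only [_root_.add_apply, _root_.smul_apply, smul_eq_mul]
    ring
  -- (1) the bracket: `w DG(V) + G (w Dψ(V)) + 3γ G w ≤ -G w`
  have hT1 : ∀ y, w y * fderiv ℝ G y (V y) + G y * (Real.exp (ψ y) * τ y * fderiv ℝ ψ y (V y)) +
      G y * w y * (3 * γ) ≤ -(G y * w y) := by
    intro y
    by_cases hy : ‖y - c‖ ≤ 2 * R
    · have hid : fderiv ℝ G y (V y) =
          2 * a * (‖Ω y‖ ^ 2) ^ (a - 1) * (⟪Ω y, fderiv ℝ U y (Ω y)⟫ - ‖Ω y‖ ^ 2) := by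
        rw [hGdef, fderiv_rpow_norm_sq_apply_of_one_le hΩd ha1, hΩdef, hVdef,
          h.fderiv_curl_transport y, inner_sub_right, real_inner_self_eq_norm_sq]
      have hfe : 0 ≤ (‖Ω y‖ ^ 2) ^ (a - 1) := Real.rpow_nonneg (sq_nonneg _) _
      have hst : ⟪Ω y, fderiv ℝ U y (Ω y)⟫ - ‖Ω y‖ ^ 2 ≤ (m y - 1) * ‖Ω y‖ ^ 2 := by
        have := hm y hy
        linarith
      have hDG_le : fderiv ℝ G y (V y) ≤ 2 * a * (m y - 1) * G y := by
        rw [hid]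
        have hkey : (‖Ω y‖ ^ 2) ^ (a - 1) * ‖Ω y‖ ^ 2 = G y :=
          rpow_sub_one_mul_self_eq_rpow (sq_nonneg _) ha
        calc 2 * a * (‖Ω y‖ ^ 2) ^ (a - 1) * (⟪Ω y, fderiv ℝ U y (Ω y)⟫ - ‖Ω y‖ ^ 2)
            ≤ 2 * a * (‖Ω y‖ ^ 2) ^ (a - 1) * ((m y - 1) * ‖Ω y‖ ^ 2) :=
              mul_le_mul_of_nonneg_left hst (by positivity)
          _ = 2 * a * (m y - 1) * ((‖Ω y‖ ^ 2) ^ (a - 1) * ‖Ω y‖ ^ 2) := by ring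
          _ = 2 * a * (m y - 1) * G y := by rw [hkey]
      have hb := hbr y hy
      have hwy := hw_nn y
      have hGy := hG_nn y
      have e1 : w y * fderiv ℝ G y (V y) ≤ w y * (2 * a * (m y - 1) * G y) :=
        mul_le_mul_of_nonneg_left hDG_le hwy
      have e2 : G y * (Real.exp (ψ y) * τ y * fderiv ℝ ψ y (V y)) = G y * w y * fderiv ℝ ψ y (V y) := by
        simp only [hwdef]; ring
      rw [e2]
      have e3 : w y * (2 * a * (m y - 1) * G y) + G y * w y * fderiv ℝ ψ y (V y) +
          G y * w y * (3 * γ) = G y * w y * (2 * a * (m y - 1) + fderiv ℝ ψ y (V y) + 3 * γ) := by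
        ring
      have e4 : G y * w y * (2 * a * (m y - 1) + fderiv ℝ ψ y (V y) + 3 * γ) ≤
          G y * w y * (-1) := mul_le_mul_of_nonneg_left hb (mul_nonneg hGy hwy)
      linarith
    · -- outside `B̄(c, 2R)` the test function and its derivative vanish
      have hy' : 2 * R < ‖y - c‖ := not_le.1 hy
      have hτ0 : τ y = 0 := hτ_zero y hy'
      have hw0 : w y = 0 := by simp only [hwdef, hτ0, mul_zero]
      rw [hw0, hτ0]
      simp
  -- (2) the cutoff term has a sign: `G e^ψ Dτ(V) ≤ 0`
  have hT2 : ∀ y, G y * (Real.exp (ψ y) * fderiv ℝ τ y (V y)) ≤ 0 := by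
    intro y
    have hτ' : fderiv ℝ τ y (V y) ≤ 0 := by
      by_cases hy : ‖y - c‖ < R
      · have h0 : fderiv ℝ τ y = 0 := fderiv_taoCutoff_comp_sub_eq_zero_of_lt hR hy
        rw [h0]
        simp
      · have hsign : 0 ≤ ⟪y - c, V y⟫ := by
          rw [real_inner_comm]; exact hout y (not_lt.1 hy)
        rw [hτdef, fderiv_taoCutoff_comp_sub_apply]
        have h1 : 0 ≤ deriv Real.smoothTransition
            (((2 * R) ^ 2 - ‖y - c‖ ^ 2) / (R * (2 * R))) :=
          Real.smoothTransition.monotone.deriv_nonneg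
        have h2 : -(2 / (R * (2 * R))) * ⟪y - c, V y⟫ ≤ 0 := by
          have : 0 ≤ 2 / (R * (2 * R)) * ⟪y - c, V y⟫ := mul_nonneg (by positivity) hsign
          linarith
        exact mul_nonpos_of_nonneg_of_nonpos h1 h2
    have := mul_nonpos_of_nonneg_of_nonpos (Real.exp_pos (ψ y)).le hτ'
    exact mul_nonpos_of_nonneg_of_nonpos (hG_nn y) this
  have hGc' : Continuous G := hG1.continuous
  have hwc' : Continuous w := hw1.continuous
  have hIΘ : Integrable (fun y => G y * w y) := (hGc'.mul hwc').integrable_of_hasCompactSupport hΘc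
  have hIgrad : Integrable (fun y => ⟪V y, gradient (fun z => G z * w z) y⟫) := by
    refine (hV1.continuous.inner (continuous_gradient_of_contDiff hΘ1))
      |>.integrable_of_hasCompactSupport (hΘc.mono' fun x hx => ?_)
    contrapose! hx
    simp only [mem_support, not_not]
    rw [gradient_eq_zero_of_notMem_tsupport hx, inner_zero_right]
  -- assemble: `0 = ∫ (3γ Θ + ⟪V, ∇Θ⟫) ≤ -∫ Θ`
  have hptw : ∀ y, (G y * w y) * (3 * γ) + ⟪V y, gradient (fun z => G z * w z) y⟫ ≤
      -(G y * w y) := by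
    intro y
    rw [hgrad y]
    have := hT1 y
    have := hT2 y
    nlinarith [hG_nn y]
  have hle : (∫ y, (G y * w y) * (3 * γ)) + ∫ y, ⟪V y, gradient (fun z => G z * w z) y⟫ ≤
      ∫ y, -(G y * w y) := by
    rw [← integral_add (hIΘ.mul_const _) hIgrad]
    exact integral_mono ((hIΘ.mul_const _).add hIgrad) hIΘ.neg hptw
  rw [hibp, integral_neg] at hle
  -- hence `∫ Θ = 0`, so `Θ ≡ 0` by continuity
  have hΘ_nn : ∀ y, 0 ≤ G y * w y := fun y => mul_nonneg (hG_nn y) (hw_nn y)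
  have hI0 : ∫ y, G y * w y = 0 := le_antisymm (by linarith) (integral_nonneg hΘ_nn)
  have hae : (fun y => G y * w y) =ᵐ[volume] 0 :=
    (integral_eq_zero_iff_of_nonneg hΘ_nn hIΘ).1 hI0
  have hΘ0 : (fun y => G y * w y) = 0 := ((hGc'.mul hwc').ae_eq_iff_eq volume continuous_zero).1 hae
  -- read off `Ω = 0` on `B̄(c, R)`, where `τ = 1`
  intro y hy
  have hτ1' : τ y = 1 := taoCutoff_comp_sub_eq_one hR hy
  have hwy : 0 < w y := by
    simp only [hwdef, hτ1', mul_one]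
    exact Real.exp_pos _
  have hGy : G y = 0 := by
    have e := congrFun hΘ0 y
    simp only [Pi.zero_apply, mul_eq_zero] at e
    rcases e with e | e
    · exact e
    · exact absurd e hwy.ne'
  have hsq : ‖Ω y‖ ^ 2 = 0 := by
    rcases (Real.rpow_eq_zero (sq_nonneg _) ha.ne').1 hGy with h0
    exact h0
  have : Ω y = 0 := by
    rw [← norm_eq_zero]
    exact pow_eq_zero_iff (n := 2) (by norm_num) |>.1 hsq
  simpa [hΩdef] using this

end IsSelfSimilarEulerVorticityProfile

/-! ### The self-similar Bernoulli function is `C¹` -/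

namespace IsSelfSimilarEulerProfile

variable {γ : ℝ} {c : EuclideanSpace ℝ (Fin 3)}
  {U : EuclideanSpace ℝ (Fin 3) → EuclideanSpace ℝ (Fin 3)} {P : EuclideanSpace ℝ (Fin 3) → ℝ}

/-- The self-similar Bernoulli function of a profile is `C¹`. [cite: ConstantinIgnatovaVicol2026Putative, §3.4.3 eq. (3.30)] -/
theorem contDiff_selfSimilarBernoulli (h : IsSelfSimilarEulerProfile γ c U P) :
    ContDiff ℝ 1 (selfSimilarBernoulli γ c U P) := by
  have hV : ContDiff ℝ 1 fun y : EuclideanSpace ℝ (Fin 3) => γ • (y - c) + U y :=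
    ((contDiff_id.sub contDiff_const).const_smul γ).add (h.contDiff_velocity.of_le (by norm_num))
  have h1 : ContDiff ℝ 1 fun y : EuclideanSpace ℝ (Fin 3) => ‖γ • (y - c) + U y‖ ^ 2 :=
    hV.norm_sq ℝ
  have h2 : ContDiff ℝ 1 fun y : EuclideanSpace ℝ (Fin 3) => ‖y - c‖ ^ 2 :=
    (contDiff_id.sub contDiff_const).norm_sq ℝ
  have : ContDiff ℝ 1 fun y : EuclideanSpace ℝ (Fin 3) =>
      (1 / 2 : ℝ) * ‖γ • (y - c) + U y‖ ^ 2 + P y + γ * (γ - 1) / 2 * ‖y - c‖ ^ 2 :=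
    ((contDiff_const.mul h1).add h.contDiff_pressure).add (contDiff_const.mul h2)
  exact this

end IsSelfSimilarEulerProfile
end Literature.Analysis.FluidPDE

end
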